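/-
Copyright (c) 2026 the pub-hodgecm-mathlib formalisation cell (harness21).  Prover seat hodgecm-mathlib-K2E3-p29 (g4), Track B ∕ R90-TF, h413 = `stmt-HodgeConjecture-24833`,
R90-TF section S8 «ContSpec-n½» (S8 dealer R90-CS-plan (g3) S8-R240 (3)): the STRUCTURE half of the visible binder `harchτ` of K2E2-p12 (g10)'s ∀-generator Euler factorisation
(S8-R239 (3)) — SCHUR ON A MULTIPLICITY-ONE `K`-TYPE, hypothesis-first: a `K`-equivariant linear map out of an IRREDUCIBLE finite-dimensional `K`-stable block `W` occurring with
MULTIPLICITY ONE in its `K`-isotypic component is a SCALAR multiple of the inclusion; a `K`-equivariant endomorphism (family) `T z` therefore preserves `W` and acts on it by a scalar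
`c z`, and `c` is holomorphic wherever one non-zero coordinate `z ↦ ℓ(T z w)` is.  The VALUE of the scalar (the archimedean Gamma factor) is NOT claimed — shape, not value.
-/
import Summits.HodgeConjecture.HodgeConjecture.Theorems.R90S8ChiSectionKTypeIsotypicU3   -- ★ (3′) (K2E1-p11): `chiSectionPairSubrep`, `chiSectionSpacePairKType` (the `τ`-isotypic pair-section space), `range_le_chiSectionSpacePairKType`; brings ★ `Representation.homRangeSum`
import Mathlib.RepresentationTheory.Irreducible                                          -- Mathlib `Representation.IsIrreducible`, Schur: `IsIrreducible.algebraMap_intertwiningMap_bijective_of_isAlgClosed`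
import Mathlib.Analysis.Complex.Polynomial.Basic                                          -- Mathlib `Complex.isAlgClosed`
import HarnessLib

/-!
# S8 (R)′∕(V) road, letter `harchτ` (structure half) — `R90S8ArchIntertwinerScalarOnKTypeU3`: SCHUR ON A MULTIPLICITY-ONE `K`-TYPE — AN EQUIVARIANT OPERATOR ACTS ON THE BLOCK BY A SCALAR,
# HOLOMORPHIC IN THE PARAMETER WHEREVER ONE NON-ZERO COORDINATE IS

Track B ∕ R90-TF, crux h413 = `stmt-HodgeConjecture-24833`, route of record `HCCMUnconditional`; cell `hodgecm-mathlib`, R90-TF section S8 «ContSpec-n½ ∕ ResidualSpectrum», sockets (R)′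
(B ED. 7 :337, the hSCAT rows) and (V♭) (`hfacτ`): the per-generator letter `hunfK^φ` of ★ p864823 (K2E2-p12) factors the unfolded intertwining integral as «scattering scalar ×
holomorphic amplitude»; at a one-dimensional `K_∞`-type the amplitude is the scalar phase (K2E1-p14's `hunfK_of_core`), at an EXOTIC `K_∞`-type `τ` the payer needs `harchτ` = «the
archimedean intertwiner acts on the `τ`-block by a scalar `c_τ(z)`».  THIS FILE pays the STRUCTURE of that letter (existence of the scalar, stability of the block, holomorphy of
`z ↦ c_τ(z)` read off one coordinate); the VALUE `c_τ(z)` (Gamma factors, [Knapp1986, VII §§1–2]) stays an honest L letter of the payer.  THEOREMS ONLY (no `def`, no `instance`, no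
`notation`, no named-fact hypothesis, no `sorry`; default heartbeats); lane `--supports stmt-HodgeConjecture-24833 --as helper` (count-neutral).  CLOSES NO SOCKET.  LETTER-FREE.

THE MATHEMATICS ([Knapp1986, Prop. 1.5 (Schur), VIII §3]; [WallachRRG1, §1.4.7, §3.3.1]; [DeitmarEchterhoff2014, Lemma 6.1.7]; [BorelJacquet1979, §4.6]).  Let `ρ` be a representation of
a group `K` on a complex vector space `V`, `W ≤ V` a `K`-stable FINITE-DIMENSIONAL subspace on which `ρ` is IRREDUCIBLE (`τ := ρ|_W`), and suppose `W` has MULTIPLICITY ONE in its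
isotypic component: the `τ`-part `V(τ) = Σ_{S ∈ Hom_K(τ, ρ)} S(W)` (★ `Representation.homRangeSum ρ τ`, Wallach's `V(γ)`, [WallachRRG1, §1.4.7]) is `W` itself (`hone : homRangeSum ρ τ ≤ W`; the
reverse inclusion always holds).  Then every `K`-map `S : τ → ρ` lands in `V(τ) ≤ W`, so co-restricts to a `K`-endomorphism of the irreducible finite-dimensional `τ`, which is a
scalar by Schur's lemma over the algebraically closed field `ℂ` (Mathlib `Representation.IsIrreducible.algebraMap_intertwiningMap_bijective_of_isAlgClosed`): `S = c • ι_W` (§1).  A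
`K`-equivariant linear endomorphism `T` of `V` (equivariance is only used ON `W`) restricts to such an `S`, so `T w = c • w` on `W` — `T` PRESERVES `W` and acts by a SCALAR; for a
family `T z` one gets a scalar function `c(z)`, and since `c(z) = ℓ(T z w) ∕ ℓ(w)` for any linear functional `ℓ` and `w ∈ W` with `ℓ(w) ≠ 0`, `c` is holomorphic on any set where
`z ↦ ℓ(T z w)` is (§2; for spaces of functions `ℓ` = evaluation at a point `x₀` with `w(x₀) ≠ 0`).  §3 reads all this in the (3′) SECTION CURRENCY of ★ `R90S8ChiSectionKTypeIsotypicU3`: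
`K` abstract with `ιK : K →* G(𝔸_F)` commuting with the level (`hcomm`; at `K := ↥(archMaximalCompact L)`, `ιK := (archMaximalCompact L).subtype` this is the J-S8-CO card's
`RINF := (rightTranslation G).comp (archMaximalCompact L).subtype` and `TAU := Subrepresentation.toRepresentation ⟨W₀, hW₀K⟩`), the block `W₀ : Submodule ℂ (G(𝔸_F) → ℂ)` with `hW₀K`,
and MULTIPLICITY ONE spelled with THE ISOTYPIC-COMPONENT DECL OF RECORD ★ `chiSectionSpacePairKType χ₁ χ₂ K′ ω ιK hcomm TAU` («the `τ`-part `V(χ₁, χ₂; K′, ω)^τ` of the pair-section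
space IS the block»: `hone : chiSectionSpacePairKType … TAU ≤ W₀`).
* §1 (generic `K`, `V`) **`exists_eq_smul_of_isIrreducible`** (Schur, pointwise: an equivariant endomorphism of an irreducible f.d. `τ` is `c • id`), **`exists_eq_smul_coe_of_forall_mem`**
  (a `K`-map `S : τ_W → ρ` WITH VALUES IN `W` is `c • ι_W`), **`exists_eq_smul_coe_of_homRangeSum_le`** (the same under MULTIPLICITY ONE `hone : homRangeSum ρ τ_W ≤ W`),
  **`exists_smul_of_commuteOn`** (an endomorphism `T : V →ₗ V` equivariant on `W` acts on `W` by a scalar) + `apply_mem_of_commuteOn` (`T` preserves `W`).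
* §2 (families, holomorphy) **`exists_scalarFamily_of_commuteOn`** (`∃ c : ℂ → ℂ, ∀ z, ∀ w ∈ W, T z w = c z • w`), `scalar_eq_div_of_apply_ne_zero` (`c = ℓ(T w) ∕ ℓ(w)`), `eqOn_scalarFamily_div`,
  **`differentiableOn_scalarFamily`** (`c` holomorphic on `U` if `z ↦ ℓ(T z w)` is, `ℓ w ≠ 0`), `continuousOn_scalarFamily`.
* §3 (the (3′) section currency, generic quadratic datum `(F, E, c)`, rank 3) **`exists_eq_smul_coe_of_kTypePart_le`** (a `K`-equivariant `S : ↥W₀ →ₗ (G(𝔸_F) → ℂ)` with values in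
  `V(χ₁, χ₂; K′, ω)` is `c • ι_{W₀}` when `V^τ ≤ W₀`), **`exists_scalarFamily_of_kTypePart_le`** (a family `T z : (G(𝔸_F) → ℂ) →ₗ (G(𝔸_F) → ℂ)` mapping `W₀` into sections, equivariant on
  `W₀`: `∃ c, ∀ z, ∀ ψ ∈ W₀, T z ψ = c z • ψ`), **`differentiableOn_scalarFamily_of_apply_ne_zero`** (holomorphy of `c` on `U` from holomorphy of ONE coordinate `z ↦ T z ψ x₀`,
  `ψ x₀ ≠ 0`), `exists_apply_ne_zero_of_ne_bot` (a non-zero coordinate exists as soon as `W₀ ≠ ⊥`).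
NOT CLAIMED: the value of the scalar (archimedean Gamma factors); multiplicity one itself (it is the (α)∕12d-C_τ port's output, K2E1-p16∕K2E1-p12); any analytic property of `T z` beyond
the one coordinate supplied.
HONEST LABEL: HC_CM is proved only modulo the 7 printed citations (2 remaining named inputs: hLiu418 = `stmt-HodgeConjecture-24832`, h413 = `stmt-HodgeConjecture-24833`) until
rung 0 closes; `harchτ`'s structure goes L → ★-able, its value stays L; pays no socket; REL ≠ ★ ≠ BUILT; count-neutral.

## References
* [Knapp1986] A. W. Knapp, *Representation Theory of Semisimple Groups: An Overview Based on Examples* (Princeton, 1986), Prop. 1.5 (Schur's lemma), VII §§1–2, VIII §3 (intertwining operators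
  and their action on `K`-types).
* [WallachRRG1] N. R. Wallach, *Real Reductive Groups I* (1988), §1.4.7 (`V(γ)`), §3.3.1 (`K`-finite vectors, admissibility).
* [DeitmarEchterhoff2014] A. Deitmar, S. Echterhoff, *Principles of Harmonic Analysis*, 2nd ed. (2014), Lemma 6.1.7 (Schur).
* [BorelJacquet1979] A. Borel, H. Jacquet, *Automorphic forms and automorphic representations*, Proc. Symp. Pure Math. 33.1 (1979), §4.6 (`K`-types, admissibility).
* [MoeglinWaldspurger1995] C. Mœglin, J.-L. Waldspurger, *Spectral Decomposition and Eisenstein Series* (1995), I.2.17, IV.1.9–IV.1.11 (intertwining operators on `K`-finite sections).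
-/

set_option autoImplicit false
set_option linter.dupNamespace false  -- the mandated namespace `…HodgeConjecture.HodgeConjecture.R90.S8` (LEAD #1 L1) repeats the summit's segment

noncomputable section

open MeasureTheory Measure Set Filter Topology NumberField ContRepresentation
open Literature.NumberTheory Literature.NumberTheory.Automorphic Literature.NumberTheory.Automorphic.UnitaryGroup Literature.NumberTheory.GaloisRepresentations AdelicGroupData
open Literature.NumberTheory.Automorphic.Arthur2013.Leaves.TECR Literature.NumberTheory.Rogawski1990
open Summit.HodgeConjecture.HodgeConjecture.Cruxes.H413.K2E1BorelEisensteinU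
open Summit.HodgeConjecture.HodgeConjecture.Cruxes.H413.K2E1CharacterEisensteinU3PairDefs
open Summit.HodgeConjecture.HodgeConjecture.Cruxes.H413.K2E1ChiSectionSpaceU3PairDefs
open scoped ENNReal NNReal

namespace Summit.HodgeConjecture.HodgeConjecture.R90.S8

/-! ## §1 Schur on a multiplicity-one `K`-type (generic `K`, `V`) -/

section Generic

variable {K : Type*} [Group K] {V : Type*} [AddCommGroup V] [Module ℂ V]

/-- **SCHUR, POINTWISE**: a `K`-equivariant linear endomorphism `E` of an IRREDUCIBLE finite-dimensional complex representation `τ` is a scalar: `E w = c • w` (Mathlib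
`Representation.IsIrreducible.algebraMap_intertwiningMap_bijective_of_isAlgClosed`, read pointwise). [cite: Knapp1986, Prop. 1.5] [cite: DeitmarEchterhoff2014, Lemma 6.1.7] -/
theorem exists_eq_smul_of_isIrreducible {W : Type*} [AddCommGroup W] [Module ℂ W] [FiniteDimensional ℂ W] (τ : Representation ℂ K W) (hirr : τ.IsIrreducible)
    (E : W →ₗ[ℂ] W) (hE : ∀ (k : K) (w : W), E (τ k w) = τ k (E w)) :
    ∃ c : ℂ, ∀ w : W, E w = c • w := by
  haveI := hirr
  obtain ⟨c, hc⟩ := (Representation.IsIrreducible.algebraMap_intertwiningMap_bijective_of_isAlgClosed (ρ := τ)).2 (E.intertwiningMap_of_isIntertwiningMap τ τ hE)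
  refine ⟨c, fun w => ?_⟩
  have h := congrArg (fun F : τ.IntertwiningMap τ => F w) hc
  simp only [Representation.IntertwiningMap.algebraMap_apply, Representation.IntertwiningMap.smul_apply, LinearMap.toIntertwiningMap] at h
  rw [← h]
  rfl

/-- **A `K`-MAP OUT OF AN IRREDUCIBLE f.d. STABLE BLOCK WITH VALUES IN THE BLOCK IS A SCALAR MULTIPLE OF THE INCLUSION**: for `W ≤ V` `K`-stable (`hWK`), finite-dimensional, `ρ|_W`
irreducible, and `S : ↥W →ₗ V` equivariant (`S(τ k w) = ρ k (S w)`) with `S w ∈ W` for all `w`: `S w = c • w`. [cite: Knapp1986, Prop. 1.5] [cite: WallachRRG1, §1.4.7] -/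
theorem exists_eq_smul_coe_of_forall_mem (ρ : Representation ℂ K V) (W : Submodule ℂ V) (hWK : ∀ k : K, ∀ w ∈ W, ρ k w ∈ W) [FiniteDimensional ℂ ↥W]
    (hirr : (Subrepresentation.toRepresentation (⟨W, hWK⟩ : Subrepresentation ρ)).IsIrreducible)
    (S : ↥W →ₗ[ℂ] V) (hS : ∀ (k : K) (w : ↥W), S ((Subrepresentation.toRepresentation (⟨W, hWK⟩ : Subrepresentation ρ)) k w) = ρ k (S w)) (hSW : ∀ w : ↥W, S w ∈ W) :
    ∃ c : ℂ, ∀ w : ↥W, S w = c • (w : V) := by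
  -- co-restrict `S` to a `K`-endomorphism of `τ := ρ|_W`
  obtain ⟨c, hc⟩ := exists_eq_smul_of_isIrreducible (Subrepresentation.toRepresentation (⟨W, hWK⟩ : Subrepresentation ρ)) hirr (LinearMap.codRestrict W S hSW) (fun k w =>
    Subtype.ext (by rw [LinearMap.codRestrict_apply]; exact hS k w))
  exact ⟨c, fun w => by simpa only [LinearMap.codRestrict_apply, Submodule.coe_smul] using congrArg Subtype.val (hc w)⟩

/-- **SCHUR ON A MULTIPLICITY-ONE `K`-TYPE**: for `W ≤ V` `K`-stable, finite-dimensional, `ρ|_W` irreducible, of MULTIPLICITY ONE in its isotypic component — the `τ`-part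
`V(τ) = Σ_{S ∈ Hom_K(τ, ρ)} S(W)` (★ `Representation.homRangeSum`, Wallach's `V(γ)`) is `W` itself (`hone`; `W ≤ V(τ)` always) — EVERY `K`-map `S : τ → ρ` is `c • ι_W`. [cite: WallachRRG1, §1.4.7, §3.3.1]
[cite: Knapp1986, Prop. 1.5] [cite: BorelJacquet1979, §4.6] -/
theorem exists_eq_smul_coe_of_homRangeSum_le (ρ : Representation ℂ K V) (W : Submodule ℂ V) (hWK : ∀ k : K, ∀ w ∈ W, ρ k w ∈ W) [FiniteDimensional ℂ ↥W]
    (hirr : (Subrepresentation.toRepresentation (⟨W, hWK⟩ : Subrepresentation ρ)).IsIrreducible)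
    (hone : Representation.homRangeSum ρ (Subrepresentation.toRepresentation (⟨W, hWK⟩ : Subrepresentation ρ)) ≤ W)
    (S : ↥W →ₗ[ℂ] V) (hS : ∀ (k : K) (w : ↥W), S ((Subrepresentation.toRepresentation (⟨W, hWK⟩ : Subrepresentation ρ)) k w) = ρ k (S w)) :
    ∃ c : ℂ, ∀ w : ↥W, S w = c • (w : V) :=
  exists_eq_smul_coe_of_forall_mem ρ W hWK hirr S hS fun w =>
    hone (Representation.apply_mem_homRangeSum (S.intertwiningMap_of_isIntertwiningMap _ ρ hS) w)

/-- **AN EQUIVARIANT ENDOMORPHISM ACTS ON A MULTIPLICITY-ONE `K`-TYPE BY A SCALAR**: `T : V →ₗ V` with `T(ρ k w) = ρ k (T w)` for `w ∈ W` (equivariance is only used ON `W`), `W` as in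
`exists_eq_smul_coe_of_homRangeSum_le`: `∃ c, ∀ w ∈ W, T w = c • w` — in particular `T` PRESERVES `W`. [cite: Knapp1986, Prop. 1.5, VIII §3] [cite: WallachRRG1, §1.4.7] -/
theorem exists_smul_of_commuteOn (ρ : Representation ℂ K V) (W : Submodule ℂ V) (hWK : ∀ k : K, ∀ w ∈ W, ρ k w ∈ W) [FiniteDimensional ℂ ↥W]
    (hirr : (Subrepresentation.toRepresentation (⟨W, hWK⟩ : Subrepresentation ρ)).IsIrreducible)
    (hone : Representation.homRangeSum ρ (Subrepresentation.toRepresentation (⟨W, hWK⟩ : Subrepresentation ρ)) ≤ W)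
    (T : V →ₗ[ℂ] V) (hT : ∀ (k : K), ∀ w ∈ W, T (ρ k w) = ρ k (T w)) :
    ∃ c : ℂ, ∀ w ∈ W, T w = c • w := by
  obtain ⟨c, hc⟩ := exists_eq_smul_coe_of_homRangeSum_le ρ W hWK hirr hone (T ∘ₗ W.subtype) (fun k w => hT k w w.2)
  exact ⟨c, fun w hw => hc ⟨w, hw⟩⟩

/-- The scalar form `T w = c • w` on `W` makes `T` PRESERVE `W`. [cite: Knapp1986, VIII §3] -/
theorem apply_mem_of_eq_smul {W : Submodule ℂ V} {T : V →ₗ[ℂ] V} {c : ℂ} (hc : ∀ w ∈ W, T w = c • w) {w : V} (hw : w ∈ W) : T w ∈ W := by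
  rw [hc w hw]
  exact W.smul_mem c hw

/-- **`T` PRESERVES THE MULTIPLICITY-ONE BLOCK** (`W.map T ≤ W`). [cite: Knapp1986, VIII §3] [cite: WallachRRG1, §1.4.7] -/
theorem apply_mem_of_commuteOn (ρ : Representation ℂ K V) (W : Submodule ℂ V) (hWK : ∀ k : K, ∀ w ∈ W, ρ k w ∈ W) [FiniteDimensional ℂ ↥W]
    (hirr : (Subrepresentation.toRepresentation (⟨W, hWK⟩ : Subrepresentation ρ)).IsIrreducible)
    (hone : Representation.homRangeSum ρ (Subrepresentation.toRepresentation (⟨W, hWK⟩ : Subrepresentation ρ)) ≤ W)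
    (T : V →ₗ[ℂ] V) (hT : ∀ (k : K), ∀ w ∈ W, T (ρ k w) = ρ k (T w)) {w : V} (hw : w ∈ W) : T w ∈ W := by
  obtain ⟨c, hc⟩ := exists_smul_of_commuteOn ρ W hWK hirr hone T hT
  exact apply_mem_of_eq_smul hc hw

/-! ## §2 Families `T z` and the holomorphy of the scalar, read off one non-zero coordinate -/

/-- **A FAMILY OF EQUIVARIANT ENDOMORPHISMS ACTS ON THE BLOCK BY A SCALAR FUNCTION**: `∃ c : ℂ → ℂ, ∀ z, ∀ w ∈ W, T z w = c z • w`. [cite: Knapp1986, VIII §3] [cite: MoeglinWaldspurger1995, IV.1.9] -/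
theorem exists_scalarFamily_of_commuteOn (ρ : Representation ℂ K V) (W : Submodule ℂ V) (hWK : ∀ k : K, ∀ w ∈ W, ρ k w ∈ W) [FiniteDimensional ℂ ↥W]
    (hirr : (Subrepresentation.toRepresentation (⟨W, hWK⟩ : Subrepresentation ρ)).IsIrreducible)
    (hone : Representation.homRangeSum ρ (Subrepresentation.toRepresentation (⟨W, hWK⟩ : Subrepresentation ρ)) ≤ W)
    (T : ℂ → V →ₗ[ℂ] V) (hT : ∀ (z : ℂ) (k : K), ∀ w ∈ W, T z (ρ k w) = ρ k (T z w)) :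
    ∃ c : ℂ → ℂ, ∀ (z : ℂ), ∀ w ∈ W, T z w = c z • w := by
  choose c hc using fun z => exists_smul_of_commuteOn ρ W hWK hirr hone (T z) (hT z)
  exact ⟨c, hc⟩

/-- **THE SCALAR IS A QUOTIENT OF COORDINATES**: if `T w = c • w` and `ℓ w ≠ 0` for a linear functional `ℓ`, then `c = ℓ(T w) ∕ ℓ(w)`. [cite: Knapp1986, VIII §3] -/
theorem scalar_eq_div_of_apply_ne_zero {T : V →ₗ[ℂ] V} {c : ℂ} {w : V} (hc : T w = c • w) (ℓ : V →ₗ[ℂ] ℂ) (hℓ : ℓ w ≠ 0) : c = ℓ (T w) / ℓ w := by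
  rw [hc, map_smul, smul_eq_mul, mul_div_cancel_right₀ c hℓ]

/-- On any set `U` where `T z w = c z • w`, the scalar function agrees with the coordinate quotient `z ↦ ℓ(T z w) ∕ ℓ(w)` (`ℓ w ≠ 0`) — transfer of ANY regularity of one coordinate to `c`.
[cite: Knapp1986, VIII §3] -/
theorem eqOn_scalarFamily_div {T : ℂ → V →ₗ[ℂ] V} {c : ℂ → ℂ} {U : Set ℂ} {w : V} (hc : ∀ z ∈ U, T z w = c z • w) (ℓ : V →ₗ[ℂ] ℂ) (hℓ : ℓ w ≠ 0) :
    Set.EqOn c (fun z => ℓ (T z w) / ℓ w) U :=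
  fun z hz => scalar_eq_div_of_apply_ne_zero (hc z hz) ℓ hℓ

/-- **HOLOMORPHY OF THE SCALAR, READ OFF ONE NON-ZERO COORDINATE**: if `T z w = c z • w` on `U`, `ℓ w ≠ 0`, and `z ↦ ℓ(T z w)` is holomorphic on `U`, then `c` is holomorphic on `U`.
[cite: Knapp1986, VIII §3] [cite: MoeglinWaldspurger1995, IV.1.9–IV.1.11] -/
theorem differentiableOn_scalarFamily {T : ℂ → V →ₗ[ℂ] V} {c : ℂ → ℂ} {U : Set ℂ} {w : V} (hc : ∀ z ∈ U, T z w = c z • w) (ℓ : V →ₗ[ℂ] ℂ) (hℓ : ℓ w ≠ 0)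
    (hhol : DifferentiableOn ℂ (fun z => ℓ (T z w)) U) : DifferentiableOn ℂ c U :=
  (hhol.div_const (ℓ w)).congr (eqOn_scalarFamily_div hc ℓ hℓ)

/-- Continuity of the scalar on `U` from continuity of one non-zero coordinate. [cite: Knapp1986, VIII §3] -/
theorem continuousOn_scalarFamily {T : ℂ → V →ₗ[ℂ] V} {c : ℂ → ℂ} {U : Set ℂ} {w : V} (hc : ∀ z ∈ U, T z w = c z • w) (ℓ : V →ₗ[ℂ] ℂ) (hℓ : ℓ w ≠ 0)
    (hcont : ContinuousOn (fun z => ℓ (T z w)) U) : ContinuousOn c U :=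
  (hcont.div_const (ℓ w)).congr (eqOn_scalarFamily_div hc ℓ hℓ)

end Generic

/-! ## §3 The same in the (3′) section currency: blocks of pair-sections, multiplicity one via the `τ`-isotypic pair-section space of record -/

section Sections

variable {F E : Type} [Field F] [NumberField F] [Field E] [NumberField E] [Algebra F E] {c : E ≃ₐ[F] E}
  {K : Type*} [Group K]
  {χ₁ : HeckeCharacter E} {χ₂ : ↥(TorusDict.torus c) →ₜ* ℂˣ} {K' : Subgroup (quasiSplit F E c 3).Adelic} {ω : ↥K' → ℂ}
  {ιK : K →* (quasiSplit F E c 3).Adelic} (hcomm : ∀ k : K, ∀ k' ∈ K', k' * ιK k = ιK k * k')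

/-- **SCHUR ON A MULTIPLICITY-ONE `K`-TYPE OF PAIR-SECTIONS**: `W₀ ≤ (G(𝔸_F) → ℂ)` a finite-dimensional `ιK(K)`-stable block (`hW₀K`, the J-S8-CO card's bytes at `K := ↥(archMaximalCompact L)`,
`ιK := (archMaximalCompact L).subtype`), irreducible as a `K`-module (`TAU := Subrepresentation.toRepresentation ⟨W₀, hW₀K⟩`), of MULTIPLICITY ONE among the `(χ₁, χ₂; K′, ω)`-pair-sections:
the `τ`-isotypic pair-section space of record ★ `chiSectionSpacePairKType χ₁ χ₂ K′ ω ιK hcomm TAU` is `≤ W₀`.  Then every `K`-equivariant linear `S : ↥W₀ →ₗ (G(𝔸_F) → ℂ)` WITH VALUES IN THE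
PAIR-SECTION SPACE is `c • ι_{W₀}` (★ L3 `range_le_chiSectionSpacePairKType` puts `S(W₀)` inside `V^τ ≤ W₀`, then §1). [cite: WallachRRG1, §1.4.7, §3.3.1] [cite: Knapp1986, Prop. 1.5, VIII §3]
[cite: MoeglinWaldspurger1995, I.2.17] -/
theorem exists_eq_smul_coe_of_kTypePart_le (W₀ : Submodule ℂ ((quasiSplit F E c 3).Adelic → ℂ)) (hW₀K : ∀ k : K, ∀ ψ ∈ W₀, ((rightTranslation (quasiSplit F E c 3)).comp ιK) k ψ ∈ W₀)
    [FiniteDimensional ℂ ↥W₀] (hirr : (Subrepresentation.toRepresentation (⟨W₀, hW₀K⟩ : Subrepresentation ((rightTranslation (quasiSplit F E c 3)).comp ιK))).IsIrreducible)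
    (hone : chiSectionSpacePairKType χ₁ χ₂ K' ω ιK hcomm (Subrepresentation.toRepresentation (⟨W₀, hW₀K⟩ : Subrepresentation ((rightTranslation (quasiSplit F E c 3)).comp ιK))) ≤ W₀)
    (S : ↥W₀ →ₗ[ℂ] ((quasiSplit F E c 3).Adelic → ℂ)) (hSV : ∀ w : ↥W₀, S w ∈ chiSectionSpacePair χ₁ χ₂ K' ω)
    (hS : ∀ (k : K) (w : ↥W₀), S ((Subrepresentation.toRepresentation (⟨W₀, hW₀K⟩ : Subrepresentation ((rightTranslation (quasiSplit F E c 3)).comp ιK))) k w) = rightTranslation (quasiSplit F E c 3) (ιK k) (S w)) :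
    ∃ a : ℂ, ∀ w : ↥W₀, S w = a • (w : (quasiSplit F E c 3).Adelic → ℂ) :=
  exists_eq_smul_coe_of_forall_mem ((rightTranslation (quasiSplit F E c 3)).comp ιK) W₀ hW₀K hirr S (fun k w => by rw [MonoidHom.comp_apply]; exact hS k w) fun w =>
    hone (apply_mem_chiSectionSpacePairKType S hSV hS w)

/-- **A FAMILY OF EQUIVARIANT OPERATORS ON FUNCTIONS ACTS ON A MULTIPLICITY-ONE BLOCK OF PAIR-SECTIONS BY A SCALAR FUNCTION**: `T z : (G(𝔸_F) → ℂ) →ₗ (G(𝔸_F) → ℂ)` mapping `W₀` into the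
pair-section space `V(χ₁, χ₂; K′, ω)` (`hTV`) and `K`-equivariant ON `W₀` (`hT`), `W₀` as in `exists_eq_smul_coe_of_kTypePart_le`: `∃ c : ℂ → ℂ, ∀ z, ∀ ψ ∈ W₀, T z ψ = c z • ψ` — the block is
PRESERVED and the action is SCALAR (the structure of `harchτ`). [cite: Knapp1986, VIII §3] [cite: MoeglinWaldspurger1995, IV.1.9–IV.1.11] [cite: WallachRRG1, §1.4.7] -/
theorem exists_scalarFamily_of_kTypePart_le (W₀ : Submodule ℂ ((quasiSplit F E c 3).Adelic → ℂ)) (hW₀K : ∀ k : K, ∀ ψ ∈ W₀, ((rightTranslation (quasiSplit F E c 3)).comp ιK) k ψ ∈ W₀)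
    [FiniteDimensional ℂ ↥W₀] (hirr : (Subrepresentation.toRepresentation (⟨W₀, hW₀K⟩ : Subrepresentation ((rightTranslation (quasiSplit F E c 3)).comp ιK))).IsIrreducible)
    (hone : chiSectionSpacePairKType χ₁ χ₂ K' ω ιK hcomm (Subrepresentation.toRepresentation (⟨W₀, hW₀K⟩ : Subrepresentation ((rightTranslation (quasiSplit F E c 3)).comp ιK))) ≤ W₀)
    (T : ℂ → ((quasiSplit F E c 3).Adelic → ℂ) →ₗ[ℂ] ((quasiSplit F E c 3).Adelic → ℂ)) (hTV : ∀ (z : ℂ), ∀ ψ ∈ W₀, T z ψ ∈ chiSectionSpacePair χ₁ χ₂ K' ω)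
    (hT : ∀ (z : ℂ) (k : K), ∀ ψ ∈ W₀, T z (rightTranslation (quasiSplit F E c 3) (ιK k) ψ) = rightTranslation (quasiSplit F E c 3) (ιK k) (T z ψ)) :
    ∃ a : ℂ → ℂ, ∀ (z : ℂ), ∀ ψ ∈ W₀, T z ψ = a z • ψ := by
  have h : ∀ z : ℂ, ∃ a : ℂ, ∀ ψ ∈ W₀, T z ψ = a • ψ := fun z => by
    obtain ⟨a, ha⟩ := exists_eq_smul_coe_of_kTypePart_le hcomm W₀ hW₀K hirr hone (T z ∘ₗ W₀.subtype) (fun w => hTV z w w.2) (fun k w => hT z k w w.2)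
    exact ⟨a, fun ψ hψ => ha ⟨ψ, hψ⟩⟩
  choose a ha using h
  exact ⟨a, ha⟩

/-- **HOLOMORPHY OF `harchτ`'S SCALAR FROM ONE COORDINATE**: if `T z ψ = c z • ψ` on `U` for some `ψ` with `ψ x₀ ≠ 0`, and the single coordinate `z ↦ T z ψ x₀` is holomorphic on `U`, then `c` is
holomorphic on `U` (§2 with `ℓ :=` evaluation at `x₀`). [cite: Knapp1986, VIII §3] [cite: MoeglinWaldspurger1995, IV.1.9–IV.1.11] -/
theorem differentiableOn_scalarFamily_of_apply_ne_zero {X : Type*} {T : ℂ → (X → ℂ) →ₗ[ℂ] (X → ℂ)} {a : ℂ → ℂ} {U : Set ℂ} {ψ : X → ℂ} (hc : ∀ z ∈ U, T z ψ = a z • ψ)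
    {x₀ : X} (hx₀ : ψ x₀ ≠ 0) (hhol : DifferentiableOn ℂ (fun z => T z ψ x₀) U) : DifferentiableOn ℂ a U :=
  differentiableOn_scalarFamily hc (LinearMap.proj x₀) hx₀ hhol

/-- The scalar as a quotient of ONE coordinate: `c z = (T z ψ x₀) ∕ ψ x₀` on `U`. [cite: Knapp1986, VIII §3] -/
theorem eqOn_scalarFamily_div_apply {X : Type*} {T : ℂ → (X → ℂ) →ₗ[ℂ] (X → ℂ)} {a : ℂ → ℂ} {U : Set ℂ} {ψ : X → ℂ} (hc : ∀ z ∈ U, T z ψ = a z • ψ)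
    {x₀ : X} (hx₀ : ψ x₀ ≠ 0) : Set.EqOn a (fun z => T z ψ x₀ / ψ x₀) U :=
  eqOn_scalarFamily_div hc (LinearMap.proj x₀) hx₀

/-- A NON-ZERO COORDINATE EXISTS as soon as the block is non-trivial: `W₀ ≠ ⊥ ⟹ ∃ ψ ∈ W₀, ∃ x₀, ψ x₀ ≠ 0`. [cite: WallachRRG1, §1.4.7] -/
theorem exists_apply_ne_zero_of_ne_bot {X : Type*} {W₀ : Submodule ℂ (X → ℂ)} (hW₀ : W₀ ≠ ⊥) : ∃ ψ ∈ W₀, ∃ x₀ : X, ψ x₀ ≠ 0 := by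
  obtain ⟨ψ, hψ, hne⟩ := (Submodule.ne_bot_iff W₀).1 hW₀
  exact ⟨ψ, hψ, Function.ne_iff.1 hne⟩

end Sections

end Summit.HodgeConjecture.HodgeConjecture.R90.S8

end
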